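import Summits.HodgeConjecture.CorCM.GaloisOddPrimeShapesQuaternionBottom
import Summits.HodgeConjecture.CorCM.GaloisQuaternionCyclicLiftList
import HarnessLib

/-!
# `p = 23`: shapes Q×/QK are BAD (bottom `Q₃₂ × C_{23}`), GOOD Galois CM fields of degree `2ⁿ·23` (`n ≥ 6`) have shape C(r) or Dic and
# satisfy the Hodge conjecture for all powers of all their CM abelian varieties; `Gal ≅ Q_{32k} × C_{23}` is BAD

COR-CM (cell `pub-hodgecm2`), binder seat b04 (gen 40), count-neutral own lane «Galois-CM-type classification».  KERNEL ONLY: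
theorems; no definition, no named fact, no `sorry`.  `HC_CM` is neither used nor claimed.

The `p = 23` column of the classification of Galois CM fields of degree `2ⁿ·p` (gens 38–40), obtained from the parametric column
`CorCM/GaloisOddPrimeShapesQuaternionBottom` (`t = 3`) and the two-sheet norm certificate `exists_simple_degenerate_of_quaternionThirtyTwo_cyclic23_subgroup`
(`CorCM/GaloisQuaternionCyclicLiftList`): `Q₃₂ × C₂₃ ↪ Gal through c with C₂₃ normal ⟹ BAD`.  Arithmetic: `23 − 1 = 22 = 2·11`, `23 + 1 = 24 = 2³·3`, so every shape C(r)
has `ord r ∣ 2` (`j = 1`) and gen 38's residue conditions `2ⁿ ∤ 22`, `2ⁿ⁻¹ ∤ 24` hold for `n ≥ 5`.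

* `bottom_certificate_twentythree` (the hypothesis `hcert` of the parametric column, discharged), `exists_simple_degenerate_of_shape_quaternion_twentythree`
  (Q× for `n ≥ 5`, QK for `n ≥ 6`), `structure_of_forall_isNondegenerate_of_thirtytwo_dvd_twentythree` (`n ≥ 6`),
  **`hodgeConjectureFor_pow_of_forall_isNondegenerate_twentythree`** (`n ≥ 6`), `hodge_dichotomy_twentythree`,
  `exists_simple_degenerate_of_mulEquiv_quaternion_prod_cyclic_twentythree` (`Gal ≅ Q_{32k} × C_{23}`, `k ≥ 1`).

OPEN at `p = 23`: `n = 5` in shape QK (its `u`-centraliser in the Sylow `2` is `Q₁₆`; `Q₁₆ × C₂₃` has no Gauss-alphabet word —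
`(23+3)/2 = 13 > 8` slots) and `n ≤ 4` (`Q₈ × C₂₃` is GOOD: `ord₂₃ 2 = 11` is odd).

## References

* [Shimura1998] G. Shimura, *Abelian Varieties with Complex Multiplication and Modular Functions*, §6.2 Thm. 3, §8.2 Prop. 26, §32.10.
* [Gordon1999HodgeAVSurvey] B. B. Gordon, *A survey of the Hodge conjecture for abelian varieties*, Thm. 6.4, §9.3.
* [Pohlmann1968] H. Pohlmann, *Algebraic cycles on abelian varieties of complex multiplication type*, Ann. of Math. 88 (1968), Thm. 1.
* [Dodson1984] B. Dodson, *The structure of Galois groups of CM-fields*, Trans. AMS 283 (1984), §3.1.1, §4.1, §5.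
-/

noncomputable section

open CategoryTheory CategoryTheory.Limits NumberField
open scoped BigOperators

namespace Summit.HodgeConjecture.CorCM.GaloisModels

open Literature.NumberTheory.ComplexMultiplication Literature.AlgebraicGeometry.HodgeTheory
open Literature.AlgebraicGeometry.Motives (AbelianVariety CMType)
open Literature.AlgebraicGeometry.ComplexMultiplication (IsCMTypeRealisation)
open Literature.AlgebraicGeometry.Pohlmann1968 Summit.HodgeConjecture.CorCM.GaloisRank
open Literature.Barriers.HodgeConjecture (divisorClassesSpan)
open QuaternionGroup

variable {K : Type} [Field K] [NumberField K] [IsCMField K]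

/-- **The bottom certificate `Q₃₂ × C_{23} ↪ Gal(K/ℚ)` through `c` with `C_{23}` normal ⟹ BAD**, in the parametric form (`t = 3`).
[cite: Shimura1998, §6.2 Thm. 3 and §8.2 Prop. 26] [cite: Gordon1999HodgeAVSurvey, Thm. 6.4 and §9.3] -/
theorem bottom_certificate_twentythree [IsGalois ℚ K] :
    ∀ A X v : K ≃ₐ[ℚ] K, orderOf A = 2 ^ (3 + 1) → X * X = A ^ 2 ^ 3 → X * A * X⁻¹ = A⁻¹ →
      A ^ 2 ^ 3 = (IsCMField.complexConj K).restrictScalars ℚ → orderOf v = 23 → A * v = v * A → X * v = v * X →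
      (Subgroup.zpowers v).Normal →
      ∃ (Φ : CMType K) (φ₀ : K →+* ℂ) (A : AbelianVariety ℂ) (ι : 𝓞 K →+* End A)
        (θ : K →+* Module.End ℂ (complexBetti A.X 1)),
        IsPrimitive (ℂ ≃+* ℂ) Φ.1 φ₀ ∧ ¬ IsNondegenerate Φ ∧ IsCMTypeRealisation Φ A ι θ ∧ A.IsSimple ∧
        A.dim = Module.finrank ℚ K / 2 ∧
        ∃ n p : ℕ, ∃ x : complexBetti (⨁ fun _ : Fin n => A).X (2 * p), IsRationalClass x ∧
          IsOfHodgeType (⨁ fun _ : Fin n => A).dim (⨁ fun _ : Fin n => A).X (2 * p) p p x ∧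
          x ∉ divisorClassesSpan (⨁ fun _ : Fin n => A).X (⨁ fun _ : Fin n => A).dim p := by
  intro A X v hA hX hXA hc hv hAv hXv hnorm
  norm_num at hA hX hc
  exact exists_simple_degenerate_of_quaternionThirtyTwo_cyclic23_subgroup hA hX hXA hc hv hAv hXv hnorm

/-- **SHAPES Q× (`n ≥ 5`) AND QK (`n ≥ 6`) ARE BAD FOR `p = 23`** (subgroup `⟨a^{2ⁿ⁻5}, x⟩ × ⟨u⟩ ≅ Q₃₂ × C_{23}` through `c`).
[cite: Shimura1998, §6.2 Thm. 3 and §8.2 Prop. 26] [cite: Gordon1999HodgeAVSurvey, Thm. 6.4 and §9.3] -/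
theorem exists_simple_degenerate_of_shape_quaternion_twentythree [IsGalois ℚ K] {n : ℕ} (hn : 5 ≤ n) {u a x : K ≃ₐ[ℚ] K}
    (hu : orderOf u = 23) (hnorm : (Subgroup.zpowers u).Normal) (ha : orderOf a = 2 ^ (n - 1)) (hxa : x * a = a⁻¹ * x)
    (hxx : x * x = a ^ 2 ^ (n - 2)) (hc : a ^ 2 ^ (n - 2) = (IsCMField.complexConj K).restrictScalars ℚ)
    (hxu : x * u * x⁻¹ = u) (hau : a * u * a⁻¹ = u ∨ (a * u * a⁻¹ = u⁻¹ ∧ 6 ≤ n)) :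
    ∃ (Φ : CMType K) (φ₀ : K →+* ℂ) (A : AbelianVariety ℂ) (ι : 𝓞 K →+* End A)
      (θ : K →+* Module.End ℂ (complexBetti A.X 1)),
      IsPrimitive (ℂ ≃+* ℂ) Φ.1 φ₀ ∧ ¬ IsNondegenerate Φ ∧ IsCMTypeRealisation Φ A ι θ ∧ A.IsSimple ∧
      A.dim = Module.finrank ℚ K / 2 ∧
      ∃ n p : ℕ, ∃ x : complexBetti (⨁ fun _ : Fin n => A).X (2 * p), IsRationalClass x ∧
        IsOfHodgeType (⨁ fun _ : Fin n => A).dim (⨁ fun _ : Fin n => A).X (2 * p) p p x ∧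
        x ∉ divisorClassesSpan (⨁ fun _ : Fin n => A).X (⨁ fun _ : Fin n => A).dim p :=
  exists_simple_degenerate_of_shape_quaternion_of_bottom bottom_certificate_twentythree (by omega) hu hnorm ha hxa hxx hc hxu
    (hau.imp_right fun h => ⟨h.1, by omega⟩)

/-- **GOOD Galois CM fields of degree `2ⁿ·23`, `n ≥ 6`: shape C(r) or Dic.** [cite: Shimura1998, §8.2 Prop. 26 and §32.10]
[cite: Dodson1984, §3.1.1, §4.1 and §5] -/
theorem structure_of_forall_isNondegenerate_of_thirtytwo_dvd_twentythree [IsGalois ℚ K] {n : ℕ}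
    (hdeg : Module.finrank ℚ K = 2 ^ n * 23) (hn : 6 ≤ n)
    (hgood : ∀ (Φ : CMType K) (φ : K →+* ℂ), IsPrimitive (ℂ ≃+* ℂ) Φ.1 φ → IsNondegenerate Φ) [Fact (Nat.Prime 2)] :
    (∀ σ : K ≃ₐ[ℚ] K, σ * σ = 1 → σ ≠ 1 → σ = (IsCMField.complexConj K).restrictScalars ℚ) ∧
      ∀ S : Sylow 2 (K ≃ₐ[ℚ] K), Nat.card (S : Subgroup (K ≃ₐ[ℚ] K)) = 2 ^ n ∧
        ((∃ u x : K ≃ₐ[ℚ] K, orderOf u = 23 ∧ (Subgroup.zpowers u).Normal ∧ orderOf x = 2 ^ n ∧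
            Subgroup.zpowers x = (S : Subgroup (K ≃ₐ[ℚ] K)) ∧ (∀ g : K ≃ₐ[ℚ] K, ∃ j i : ℕ, g = u ^ j * x ^ i) ∧
            ∃ r : ℕ, x * u * x⁻¹ = u ^ r) ∨
         (∃ u a x : K ≃ₐ[ℚ] K, orderOf u = 23 ∧ (Subgroup.zpowers u).Normal ∧ orderOf a = 2 ^ (n - 1) ∧
            a ∈ (S : Subgroup (K ≃ₐ[ℚ] K)) ∧ x ∈ (S : Subgroup (K ≃ₐ[ℚ] K)) ∧ x ∉ Subgroup.zpowers a ∧ x * a = a⁻¹ * x ∧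
            x * x = a ^ 2 ^ (n - 2) ∧ (∀ g : K ≃ₐ[ℚ] K, ∃ j i : ℕ, g = u ^ j * a ^ i ∨ g = u ^ j * (x * a ^ i)) ∧
            a * u * a⁻¹ = u ∧ x * u * x⁻¹ = u⁻¹)) :=
  structure_of_forall_isNondegenerate_of_thirtytwo_dvd_of_bottom (t := 3) (by norm_num) (by norm_num) hdeg (by omega) (by omega)
    bottom_certificate_twentythree hgood

variable {Φ : CMType K} {A : AbelianVariety ℂ} {ι : 𝓞 K →+* End A} {θ : K →+* Module.End ℂ (complexBetti A.X 1)}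

/-- **A GOOD Galois CM field of degree `2ⁿ·23`, `n ≥ 6`, satisfies the Hodge conjecture for all powers of every abelian variety with CM by
`K`** (`j = 1`: `4 ∤ 22`, `2ⁿ⁻¹ ∤ 24`). [cite: Pohlmann1968, Thm. 1] [cite: Shimura1998, §8.2 Prop. 26 and §32.10]
[cite: Gordon1999HodgeAVSurvey, Thm. 6.4 and §9.3] -/
theorem hodgeConjectureFor_pow_of_forall_isNondegenerate_twentythree [IsGalois ℚ K] {n : ℕ}
    (hdeg : Module.finrank ℚ K = 2 ^ n * 23) (hn : 6 ≤ n)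
    (hgood : ∀ (Ψ : CMType K) (φ : K →+* ℂ), IsPrimitive (ℂ ≃+* ℂ) Ψ.1 φ → IsNondegenerate Ψ)
    (hA : IsCMTypeRealisation Φ A ι θ) (N : ℕ) :
    HodgeConjectureFor (⨁ fun _ : Fin N => A).dim (⨁ fun _ : Fin N => A).X :=
  hodgeConjectureFor_pow_of_forall_isNondegenerate_of_bottom (t := 3) (j := 1) (by norm_num) (by norm_num) hdeg (by omega)
    (by omega) bottom_certificate_twentythree le_rfl (by omega) (by decide) (not_two_pow_dvd_of_le (e := 4) (by omega) (by decide))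
    hgood hA N

/-- **The Hodge dichotomy for Galois CM fields of degree `2ⁿ·23`, `n ≥ 6`.** [cite: Pohlmann1968, Thm. 1]
[cite: Shimura1998, §6.2 Thm. 3, §8.2 Prop. 26 and §32.10] [cite: Gordon1999HodgeAVSurvey, Thm. 6.4 and §9.3] -/
theorem hodge_dichotomy_twentythree [IsGalois ℚ K] {n : ℕ} (hdeg : Module.finrank ℚ K = 2 ^ n * 23) (hn : 6 ≤ n) :
    (∀ (Φ : CMType K) (A : AbelianVariety ℂ) (ι : 𝓞 K →+* End A) (θ : K →+* Module.End ℂ (complexBetti A.X 1)),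
        IsCMTypeRealisation Φ A ι θ → ∀ N : ℕ, HodgeConjectureFor (⨁ fun _ : Fin N => A).dim (⨁ fun _ : Fin N => A).X) ∨
      ∃ (Φ : CMType K) (φ : K →+* ℂ) (X : AbelianVariety ℂ) (ι : 𝓞 K →+* End X)
        (ϑ : K →+* Module.End ℂ (complexBetti X.X 1)),
        IsPrimitive (ℂ ≃+* ℂ) Φ.1 φ ∧ ¬ IsNondegenerate Φ ∧ IsCMTypeRealisation Φ X ι ϑ ∧ X.IsSimple ∧
        X.dim = Module.finrank ℚ K / 2 ∧
        ∃ n p : ℕ, ∃ x : complexBetti (⨁ fun _ : Fin n => X).X (2 * p), IsRationalClass x ∧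
          IsOfHodgeType (⨁ fun _ : Fin n => X).dim (⨁ fun _ : Fin n => X).X (2 * p) p p x ∧
          x ∉ divisorClassesSpan (⨁ fun _ : Fin n => X).X (⨁ fun _ : Fin n => X).dim p :=
  hodge_dichotomy_of_bottom (t := 3) (j := 1) (by norm_num) (by norm_num) hdeg (by omega) (by omega) bottom_certificate_twentythree
    le_rfl (by omega) (by decide) (not_two_pow_dvd_of_le (e := 4) (by omega) (by decide))

/-- **`Gal(K/ℚ) ≅ Q_{32k} × C_{23}` IS BAD** for every `k ≥ 1` (`Q_{32k} = QuaternionGroup (8k)`).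
[cite: Shimura1998, §6.2 Thm. 3 and §8.2 Prop. 26] [cite: Gordon1999HodgeAVSurvey, Thm. 6.4 and §9.3] -/
theorem exists_simple_degenerate_of_mulEquiv_quaternion_prod_cyclic_twentythree [IsGalois ℚ K] {k : ℕ} [NeZero k]
    (e : (K ≃ₐ[ℚ] K) ≃* QuaternionGroup (8 * k) × Multiplicative (ZMod 23)) :
    ∃ (Φ : CMType K) (φ₀ : K →+* ℂ) (A : AbelianVariety ℂ) (ι : 𝓞 K →+* End A)
      (θ : K →+* Module.End ℂ (complexBetti A.X 1)),
      IsPrimitive (ℂ ≃+* ℂ) Φ.1 φ₀ ∧ ¬ IsNondegenerate Φ ∧ IsCMTypeRealisation Φ A ι θ ∧ A.IsSimple ∧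
      A.dim = Module.finrank ℚ K / 2 ∧
      ∃ n p : ℕ, ∃ x : complexBetti (⨁ fun _ : Fin n => A).X (2 * p), IsRationalClass x ∧
        IsOfHodgeType (⨁ fun _ : Fin n => A).dim (⨁ fun _ : Fin n => A).X (2 * p) p p x ∧
        x ∉ divisorClassesSpan (⨁ fun _ : Fin n => A).X (⨁ fun _ : Fin n => A).dim p :=
  exists_simple_degenerate_of_mulEquiv_quaternion_prod_cyclic_of_bottom (t := 3) (by decide) bottom_certificate_twentythree
    (by rwa [show (2 : ℕ) ^ 3 = 8 by norm_num])

end Summit.HodgeConjecture.CorCM.GaloisModels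

end
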